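import Literature.AlgebraicGeometry.AbelianSchemes.PELTupleSpreadStageRowsReadings   -- ★ p849005 (LA4-p01): GSPREAD-CORE⁺ over a number field `exists_stage_pelTuple_rows_cofinite_of_stageDuals`
import Literature.AlgebraicGeometry.AbelianSchemes.StageDualsOfLetter                  -- ★ p849039 (LA4-p04∕LA4-p05): «DUALS-AT-STAGE» `stageDuals_of_letter`
import Literature.AlgebraicGeometry.AbelianSchemes.AbelianSchemeOverLevelBaseChange    -- ★ `AbelianSchemeOver.baseChange_isBaseChangeVia`
import Literature.AlgebraicGeometry.Motives.IntegralModelLocaliseProperties            -- ★ `IntegralModel.locallyOfFinitePresentation_localise_total_hom`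
import Literature.AlgebraicGeometry.Motives.GaloisThickeningIntegralPackage            -- ★ `isProper_thickening` (the thickened record curve is proper)
import Literature.AlgebraicGeometry.Resolution.SmoothStalksRegular                    -- ★ `isReduced_of_smooth`
import HarnessLib

/-!
# The spread PEL tuple READ AT THE LOCALISATION `𝓜.localise w`, from the DUALS letter: rows and generic reading of the closer leaf's `PELSpreadAt`
# ([EGAIV3] 8.8.2 ∕ 8.10.5 spreading; [MumfordAV1970] §7 Thm. 4, §13; [MumfordFogartyKirwan1994] Ch. 7 §2 Def. 7.2)

Layer `Literature/AlgebraicGeometry/AbelianSchemes`, namespace `Literature.AlgebraicGeometry.Motives.IntegralModel`.  THEOREMS ONLY (no definition,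
no named fact, no instance, no notation, no `sorry`).  Cell `hodgecm-mathlib` (D-0151), P6 «MOD programme», crux hLiu418 (`stmt-HodgeConjecture-24832`,
`--supports`, count-neutral), L4 closer leaf `Lines/F0_P6a_PELSpread.lean`, socket **`stub_GSPREAD : DualPairOfAmpleRigidified → RecordESpreadCofinal`**
(LA4-plan (g0) DEAL #10, assembly pen LA4-p03).  THIS FILE IS THE LAST MILE BELOW THE LEAF: it composes the two ★ holes of the assembly — (H1) ★
`AbelianSchemeOver.stageDuals_of_letter` (the stage-duals hypothesis from the DUALS letter) and (H2) ★
`IntegralModel.exists_stage_pelTuple_rows_cofinite_of_stageDuals` (one stage tuple with its three stage rows, read cofinitely in `w`) — and delivers, at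
every good `w`, EXACTLY the rows of the leaf's carrier `PELSpreadAt` for the tuple «stage tuple base-changed along `𝓜.total ◁ τ`»: `relDim`, `comm`,
`rosati`, `polQuasiInv` (with the `pChar.Coprime d` clause for every residue characteristic `p ∈ 𝔭_w`) and the generic reading `gen_iso` in the leaf's
`genIncl` currency `((𝓜.localise w).genericIso′)⁻¹ ≫ pr₁`.  The leaf's proof of `stub_GSPREAD` is then record packaging (`rfl`∕`HEq.rfl` provenance).
HC_CM is proved only modulo the printed citations (2 remaining named inputs hLiu418 24832, h413 24833) until rung 0 closes; nothing here is about HC.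

THE MATHEMATICS.  `F` a number field, `X → Spec F` proper with reduced locally Noetherian total space, `𝓜` an integral model of `X` over `𝓞 F`
(`𝓜.genericIso : 𝓜.total ⊗_{𝓞 F} F ≅ X`) with quasi-compact, quasi-separated, locally finitely presented, flat, separated structure map;
`(A₁, ι₁, (Â₁, 𝒫₁), λ₁, φ₁)` an `𝒪`-PEL tuple over `X` of relative dimension `g`, level `N ≠ 0`, with a Rosati row for a relation `r` on `𝒪` and a
quasi-inverse `λ₁ ≫ ν₁ = [d]`, `d ≠ 0`.
* §1 `isLocallyNoetherian_tensorObj_specOver_left`, `isReduced_tensorObj_specOver_left` — the generic stage `𝓜.total ⊗ Spec F` is reduced and locally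
  Noetherian (transport along the isomorphism `𝓜.genericIso`); `isLocallyNoetherian_localise_total_left` — `(𝓜.localise w).total = 𝓜.total ⊗ Spec 𝒪_{F,(w)}`
  is locally Noetherian (`𝒪_{F,(w)}` is a DVR, ★ `locallyOfFinitePresentation_localise_total_hom`).
* §2 **`stageDuals_of_letter_genericIso`** — (H1) in the iso-base currency of (H2): the DUALS letter gives the stage-duals hypothesis for `A₁` over `X`
  along `𝓜.genericIso⁻¹ ≫ (𝓜.total ◁ π_t)` (★ `stageDuals_of_letter` for `A₁ ×_X (𝓜.total ⊗ Spec F)`, moved along `𝓜.genericIso` by ★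
  `baseChange_isBaseChangeVia` + ★ `IsBaseChangeVia.trans`).
* §3 **HEAD `exists_stage_pelTuple_localised_rows_of_letter`** — from the DUALS letter: ONE stage tuple `(s, 𝒜, ι, (Â, 𝒫), λ, φ)` over `𝓜.total ⊗ D(s)`
  and a finite `S` such that every `w ∉ S` reaches the stage by some `τ : Spec 𝒪_{F,(w)} → D(s)` and the tuple base-changed along `𝓜.total ◁ τ` has:
  relative dimension `g`; commutative group law; the Rosati row for `r`; for every prime `p ∈ 𝔭_w` a quasi-inverse `λ ≫ ν = [d]` with `p ∤ d`
  (`S ⊇ {w ∣ d}`, ★ `finite_setOf_natCast_mem_asIdeal`, ★ `coprime_of_natCast_mem_of_natCast_not_mem`); and at every `t : T′ → X` the six-clause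
  isomorphism of tuples between its reading at `genIncl ≫ t` and `(A₁, …) ×_X T′` (★ (H2) at the tower morphism `κ_w : Spec F → Spec 𝒪_{F,(w)}`, ★
  `genericIso'_inv_left_comp_fst`).  Rows by ★ `IsOfRelDim.baseChange`, ★ `isCommMonObj_of_isLocallyNoetherian_base`, ★ `RingAction.rosati_row_baseChange`,
  ★ `exists_monHom_comp_eq_mulN_baseChange`.
* §4 **`exists_stage_pelTuple_localised_rows_of_letter_thickening`** — the same for `X := R_{Fᵢ} X₀` the Galois thickening of a smooth projective curve
  `X₀ ∕ F` (the record curve `S.M Kc` of the leaf) and a polarisation of TYPE `δ`: the instances of §3 are discharged (★ `isProper_thickening`, ★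
  `isReduced_of_smooth`, Mathlib `LocallyOfFiniteType.isLocallyNoetherian`) and the E-side quasi-inverse is ★
  `Polarization.exists_monHom_quasiInverse_of_hasType_of_charZero` (`d = ∏ δᵢ ≠ 0`).

## References
* [EGAIV3] A. Grothendieck, J. Dieudonné, *Éléments de géométrie algébrique IV₃*, Publ. Math. IHÉS 28 (1966), Thm. 8.8.2, (8.8.2.5), Thm. 8.10.5.
* [MumfordAV1970] D. Mumford, *Abelian Varieties* (1970), §7 Thm. 4 (p. 72), §13 (pp. 123–125).
* [MumfordFogartyKirwan1994] D. Mumford, J. Fogarty, F. Kirwan, *Geometric Invariant Theory*, 3rd ed. (1994), Ch. 6 §1 Cor. 6.5 (p. 117), Ch. 7 §2 Def. 7.2 (p. 129), §3 Prop. 7.3 (pp. 132–134).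
* [RapoportSmithlingZhang2020Diagonal] M. Rapoport, B. Smithling, W. Zhang, *Arithmetic diagonal cycles on unitary Shimura varieties*, Compos. Math. 156 (2020), §4.1 Thm. 4.1 (p. 17).
* [Kottwitz1992] R. Kottwitz, *Points on some Shimura varieties over finite fields*, J. Amer. Math. Soc. 5 (1992), §5 (pp. 389–391).
* [SerreTate1968] J.-P. Serre, J. Tate, *Good reduction of abelian varieties*, Ann. of Math. 88 (1968), §1.
* [GortzWedhorn2020] U. Görtz, T. Wedhorn, *Algebraic Geometry I*, 2nd ed. (2020), §(4.7)–(4.8), Prop. 4.16, §(10.13).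
-/

set_option autoImplicit false

noncomputable section

-- Mathlib's `Over`∕pull-back API is stated across semireducible wrappers (as in the ★ `AbelianSchemes/*` stage files).
set_option backward.isDefEq.respectTransparency false

open CategoryTheory CategoryTheory.Limits AlgebraicGeometry MonoidalCategory IsDedekindDomain
open Literature.AlgebraicGeometry.Limits Literature.AlgebraicGeometry.Limits.LocApprox
open Literature.AlgebraicGeometry.AbelianSchemes Literature.AlgebraicGeometry.AbelianSchemes.AbelianSchemeOver
open Literature.AlgebraicGeometry.Modules Literature.AlgebraicGeometry.Morphisms
open scoped NumberField MonObj

namespace Literature.AlgebraicGeometry.Motives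

namespace IntegralModel

/-! ### §1 Instances: the generic stage and the localisation -/

section Instances

variable {F : Type} [Field F] [NumberField F] {X : SchemeOver F} (𝓜 : IntegralModel (𝓞 F) F X)

omit [NumberField F] in
/-- The generic stage `𝓜.total ⊗_{𝓞 F} F` is locally Noetherian when `X` is (it is isomorphic to `X` by `𝓜.genericIso`). [cite: SerreTate1968, §1] -/
theorem isLocallyNoetherian_tensorObj_specOver_left [IsLocallyNoetherian X.left] : IsLocallyNoetherian (𝓜.total ⊗ specOver (𝓞 F) F).left := by
  haveI : IsIso 𝓜.genericIso.hom.left := (inferInstance : IsIso ((Over.forget _).mapIso 𝓜.genericIso).hom)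
  exact isLocallyNoetherian_of_isOpenImmersion 𝓜.genericIso.hom.left

omit [NumberField F] in
/-- The generic stage `𝓜.total ⊗_{𝓞 F} F` is reduced when `X` is (it is isomorphic to `X` by `𝓜.genericIso`). [cite: SerreTate1968, §1] -/
theorem isReduced_tensorObj_specOver_left [IsReduced X.left] : IsReduced (𝓜.total ⊗ specOver (𝓞 F) F).left := by
  haveI : IsIso 𝓜.genericIso.hom.left := (inferInstance : IsIso ((Over.forget _).mapIso 𝓜.genericIso).hom)
  exact isReduced_of_isOpenImmersion 𝓜.genericIso.hom.left

/-- The localised model `(𝓜.localise w).total = 𝓜.total ⊗_{𝓞 F} 𝒪_{F,(w)}` is locally Noetherian when `𝓜.total → Spec 𝓞 F` is locally of finite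
presentation (`𝒪_{F,(w)}` is a discrete valuation ring). [cite: SerreTate1968, §1] [cite: GortzWedhorn2020, §(10.13) (pp. 261–262)] -/
theorem isLocallyNoetherian_localise_total_left [LocallyOfFinitePresentation 𝓜.total.hom] (w : HeightOneSpectrum (𝓞 F)) :
    IsLocallyNoetherian (𝓜.localise w).total.left := by
  haveI : IsDiscreteValuationRing (HeightOneSpectrum.valuationSubringAtPrime F w) :=
    IsLocalization.AtPrime.isDiscreteValuationRing_of_dedekind_domain (𝓞 F) w.ne_bot _
  haveI : LocallyOfFinitePresentation (𝓜.localise w).total.hom := 𝓜.locallyOfFinitePresentation_localise_total_hom w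
  exact LocallyOfFiniteType.isLocallyNoetherian (𝓜.localise w).total.hom

end Instances

/-! ### §2 (H1) in the iso-base currency: the stage-duals hypothesis over `X` from the DUALS letter -/

section Duals

variable {F : Type} [Field F] [NumberField F] {X : SchemeOver F} (𝓜 : IntegralModel (𝓞 F) F X)
  [QuasiCompact 𝓜.total.hom] [QuasiSeparated 𝓜.total.hom] [LocallyOfFinitePresentation 𝓜.total.hom] [Flat 𝓜.total.hom]

/-- **The stage-duals hypothesis over the identified generic fibre `X`, from the DUALS letter.**  For an abelian scheme `A₁` over `X` with a dual pair and a
polarisation, and `𝒜ₜ` over the stage `𝓜.total ⊗ D(t)` of which `A₁` is the base change along `𝓜.genericIso⁻¹ ≫ (𝓜.total ◁ π_t)`, some restriction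
`𝒜ₜ ×_{𝓜⊗D(t)} (𝓜 ⊗ D(s))` carries a dual pair — the `hdual` binder of ★ `exists_stage_pelTuple_rows_cofinite_of_stageDuals` VERBATIM: ★
`stageDuals_of_letter` for the tuple `A₁ ×_X (𝓜.total ⊗ Spec F)` over the literal generic stage, reached from `A₁` along `𝓜.genericIso.hom` (★
`baseChange_isBaseChangeVia`, ★ `IsBaseChangeVia.trans`, `genericIso.hom ≫ genericIso.inv = 𝟙`). [cite: MumfordAV1970, §13 (pp. 123–125)]
[cite: MumfordFogartyKirwan1994, Ch. 7 §2 Definition 7.2 (p. 129)] [cite: EGAIV3, Thm. 8.8.2 and Thm. 8.10.5] -/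
theorem stageDuals_of_letter_genericIso
    (hD : ∀ (R : Type) [CommRing R] [IsNoetherianRing R] (A : AbelianSchemeOver (Spec (.of R)))
      (_hA : IsProjective A.X.hom) (L : A.left.Modules) (hL : HasRank L 1),
      CechPic.pullback A.unitSection (detClass (HasRank.isFiniteLocallyFree' hL)) = 1 →
      (∀ ⦃Ω : Type⦄ [Field Ω] [IsAlgClosed Ω] (s : Spec (.of Ω) ⟶ Spec (.of R)),
        ∃ Θ : CartierDivisor (A.fibre s).toAbelianVariety.X.left, Θ.IsAmple ∧
          CechPic.pullback (X := (A.fibre s).toAbelianVariety.X.left) (pullback.fst A.X.hom s)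
            (detClass (HasRank.isFiniteLocallyFree' hL)) = Θ.cechClass) →
      ∀ (n : ℕ), IsUnit ((n : ℕ) : R) →
        (∀ (T : Over (Spec (.of R))) (u : T ⟶ A.X), A.MemKOfL L u → u ^ n = 1) →
        Nonempty A.DualPair)
    (A₁ : AbelianSchemeOver X.left) (D₁ : A₁.DualPair) (pol₁ : A₁.Polarization D₁) :
    ∀ (t : Idx (nonZeroDivisors (𝓞 F))) (𝒜ₜ : AbelianSchemeOver (𝓜.total ⊗ (baseDiagram (nonZeroDivisors (𝓞 F))).obj t).left)
      (G : A₁.X.left ⟶ 𝒜ₜ.X.left),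
      A₁.IsBaseChangeVia 𝒜ₜ (𝓜.genericIso.inv.left ≫ (𝓜.total ◁ (baseCone (nonZeroDivisors (𝓞 F)) F).π.app t).left) G →
      ∃ (s : Idx (nonZeroDivisors (𝓞 F))) (σ : s ⟶ t), Nonempty (𝒜ₜ.baseChange (stageOver (nonZeroDivisors (𝓞 F)) 𝓜.total σ).hom).DualPair := by
  haveI : ∀ s : Idx (nonZeroDivisors (𝓞 F)), IsLocallyNoetherian (𝓜.total ⊗ (baseDiagram (nonZeroDivisors (𝓞 F))).obj s).left :=
    fun s => isLocallyNoetherian_tensorObj_baseDiagram_left 𝓜.total s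
  intro t 𝒜ₜ G h
  have h' := (AbelianSchemeOver.baseChange_isBaseChangeVia A₁ 𝓜.genericIso.hom.left).trans h
  rw [← Category.assoc, ← Over.comp_left, Iso.hom_inv_id, Over.id_left, Category.id_comp] at h'
  exact AbelianSchemeOver.stageDuals_of_letter F hD _ (D₁.baseChange 𝓜.genericIso.hom.left) (pol₁.baseChange 𝓜.genericIso.hom.left) t 𝒜ₜ _ h'

end Duals

/-! ### §3 HEAD: the stage tuple read at the localisation `𝓜.localise w`, cofinitely in `w`, from the DUALS letter -/

section Head

variable {F : Type} [Field F] [NumberField F] {X : SchemeOver F} (𝓜 : IntegralModel (𝓞 F) F X)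
  [QuasiCompact 𝓜.total.hom] [QuasiSeparated 𝓜.total.hom] [LocallyOfFinitePresentation 𝓜.total.hom] [IsSeparated 𝓜.total.hom]
  [Flat 𝓜.total.hom] [IsProper X.hom] [IsLocallyNoetherian X.left] [IsReduced X.left]

/-- **THE SPREAD PEL TUPLE AT THE LOCALISATION, COFINITELY IN `w`, FROM THE DUALS LETTER** — see the module docstring, §3.  The per-`w` conclusion lists, for
the tuple `(𝒜, ι, (Â, 𝒫), λ, φ) ×_{𝓜⊗D(s)} (𝓜.localise w).total` (base change along `𝓜.total ◁ τ`, ascribed source `(𝓜.localise w).total.left`, ★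
`localise_total`): `IsOfRelDim g`; `IsCommMonObj`; the Rosati row for `r`; for every prime `p ∈ 𝔭_w` the row `∃ d′ ν, IsMonHom ν ∧ p.Coprime d′ ∧ λ ≫ ν = [d′]`;
and for every `t : T′ → X` the six clauses of an isomorphism of PEL tuples over `T′` (EXACT level, Poincaré bundle, EXACT `λ`, `𝒪`-equivariant) between the
tuple read at `((𝓜.localise w).genericIso′)⁻¹ ≫ pr₁ ≫ …` then `t`, and `(A₁, …) ×_X T′`.
[cite: EGAIV3, Thm. 8.8.2, (8.8.2.5) and Thm. 8.10.5] [cite: MumfordAV1970, §7 Thm. 4 (p. 72); §13 (pp. 123–125)]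
[cite: MumfordFogartyKirwan1994, Ch. 6 §1 Corollary 6.5 (p. 117); Ch. 7 §2 Definition 7.2 (p. 129)] [cite: RapoportSmithlingZhang2020Diagonal, §4.1 Thm. 4.1 (p. 17)]
[cite: Kottwitz1992, §5 (pp. 389–391)] [cite: SerreTate1968, §1] -/
theorem exists_stage_pelTuple_localised_rows_of_letter
    (hD : ∀ (R : Type) [CommRing R] [IsNoetherianRing R] (A : AbelianSchemeOver (Spec (.of R)))
      (_hA : IsProjective A.X.hom) (L : A.left.Modules) (hL : HasRank L 1),
      CechPic.pullback A.unitSection (detClass (HasRank.isFiniteLocallyFree' hL)) = 1 →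
      (∀ ⦃Ω : Type⦄ [Field Ω] [IsAlgClosed Ω] (s : Spec (.of Ω) ⟶ Spec (.of R)),
        ∃ Θ : CartierDivisor (A.fibre s).toAbelianVariety.X.left, Θ.IsAmple ∧
          CechPic.pullback (X := (A.fibre s).toAbelianVariety.X.left) (pullback.fst A.X.hom s)
            (detClass (HasRank.isFiniteLocallyFree' hL)) = Θ.cechClass) →
      ∀ (n : ℕ), IsUnit ((n : ℕ) : R) →
        (∀ (T : Over (Spec (.of R))) (u : T ⟶ A.X), A.MemKOfL L u → u ^ n = 1) →
        Nonempty A.DualPair)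
    {O : Type*} [CommRing O] {m : ℕ} (bs : Module.Basis (Fin m) ℤ O) {g N : ℕ} [NeZero N]
    (A₁ : AbelianSchemeOver X.left) (ρ₁ : RingAction O A₁) (D₁ : A₁.DualPair) (pol₁ : A₁.Polarization D₁)
    (φ₁ : A₁.LevelStructure g N) (hg : A₁.IsOfRelDim g)
    (r : O → O → Prop)
    (hros₁ : ∀ b b' : O, r b b' → haveI := ρ₁.isMonHom b; ρ₁.i b' ≫ pol₁.lam = pol₁.lam ≫ DualPair.dualIsogenyOver (ρ₁.i b) D₁ D₁)
    {d : ℕ} (hd : d ≠ 0) (ν₁ : D₁.hat.X ⟶ A₁.X) [IsMonHom ν₁] (hν₁ : pol₁.lam ≫ ν₁ = A₁.mulN d) :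
    ∃ (s : Idx (nonZeroDivisors (𝓞 F))) (𝒜 : AbelianSchemeOver (𝓜.total ⊗ (baseDiagram (nonZeroDivisors (𝓞 F))).obj s).left)
      (ρ : RingAction O 𝒜) (D : 𝒜.DualPair) (pol : 𝒜.Polarization D) (φ : 𝒜.LevelStructure g N),
      ∃ S : Set (HeightOneSpectrum (𝓞 F)), S.Finite ∧ ∀ w : HeightOneSpectrum (𝓞 F), w ∉ S →
        ∃ τ : specOver (𝓞 F) (HeightOneSpectrum.valuationSubringAtPrime F w) ⟶ (baseDiagram (nonZeroDivisors (𝓞 F))).obj s,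
          (𝒜.baseChange (show (𝓜.localise w).total.left ⟶ (𝓜.total ⊗ (baseDiagram (nonZeroDivisors (𝓞 F))).obj s).left from (𝓜.total ◁ τ).left)).IsOfRelDim g ∧
          IsCommMonObj (𝒜.baseChange (show (𝓜.localise w).total.left ⟶ (𝓜.total ⊗ (baseDiagram (nonZeroDivisors (𝓞 F))).obj s).left from (𝓜.total ◁ τ).left)).X ∧
          (∀ b b' : O, r b b' →
            haveI := (ρ.baseChange (show (𝓜.localise w).total.left ⟶ (𝓜.total ⊗ (baseDiagram (nonZeroDivisors (𝓞 F))).obj s).left from (𝓜.total ◁ τ).left)).isMonHom b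
            (ρ.baseChange (show (𝓜.localise w).total.left ⟶ (𝓜.total ⊗ (baseDiagram (nonZeroDivisors (𝓞 F))).obj s).left from (𝓜.total ◁ τ).left)).i b' ≫
                (pol.baseChange (show (𝓜.localise w).total.left ⟶ (𝓜.total ⊗ (baseDiagram (nonZeroDivisors (𝓞 F))).obj s).left from (𝓜.total ◁ τ).left)).lam =
              (pol.baseChange (show (𝓜.localise w).total.left ⟶ (𝓜.total ⊗ (baseDiagram (nonZeroDivisors (𝓞 F))).obj s).left from (𝓜.total ◁ τ).left)).lam ≫
                DualPair.dualIsogenyOver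
                  ((ρ.baseChange (show (𝓜.localise w).total.left ⟶ (𝓜.total ⊗ (baseDiagram (nonZeroDivisors (𝓞 F))).obj s).left from (𝓜.total ◁ τ).left)).i b)
                  (D.baseChange (show (𝓜.localise w).total.left ⟶ (𝓜.total ⊗ (baseDiagram (nonZeroDivisors (𝓞 F))).obj s).left from (𝓜.total ◁ τ).left))
                  (D.baseChange (show (𝓜.localise w).total.left ⟶ (𝓜.total ⊗ (baseDiagram (nonZeroDivisors (𝓞 F))).obj s).left from (𝓜.total ◁ τ).left))) ∧
          (∀ p : ℕ, p.Prime → (p : 𝓞 F) ∈ w.asIdeal →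
            ∃ (d' : ℕ) (ν : (D.baseChange (show (𝓜.localise w).total.left ⟶ (𝓜.total ⊗ (baseDiagram (nonZeroDivisors (𝓞 F))).obj s).left from (𝓜.total ◁ τ).left)).hat.X ⟶
                (𝒜.baseChange (show (𝓜.localise w).total.left ⟶ (𝓜.total ⊗ (baseDiagram (nonZeroDivisors (𝓞 F))).obj s).left from (𝓜.total ◁ τ).left)).X),
              IsMonHom ν ∧ p.Coprime d' ∧
                (pol.baseChange (show (𝓜.localise w).total.left ⟶ (𝓜.total ⊗ (baseDiagram (nonZeroDivisors (𝓞 F))).obj s).left from (𝓜.total ◁ τ).left)).lam ≫ ν =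
                  (𝒜.baseChange (show (𝓜.localise w).total.left ⟶ (𝓜.total ⊗ (baseDiagram (nonZeroDivisors (𝓞 F))).obj s).left from (𝓜.total ◁ τ).left)).mulN d') ∧
          ∀ {T' : Scheme.{0}} (t : T' ⟶ X.left),
            ∃ (G : (((𝒜.baseChange (show (𝓜.localise w).total.left ⟶ (𝓜.total ⊗ (baseDiagram (nonZeroDivisors (𝓞 F))).obj s).left from (𝓜.total ◁ τ).left)).baseChange
                    ((𝓜.localise w).genericIso'.inv.left ≫ pullback.fst (𝓜.localise w).total.hom
                      (Literature.NumberTheory.EllipticCurves.specGenericPoint (HeightOneSpectrum.valuationSubringAtPrime F w) F))).baseChange t).X.left ⟶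
                  (A₁.baseChange t).X.left)
              (Ĝ : (((D.baseChange (show (𝓜.localise w).total.left ⟶ (𝓜.total ⊗ (baseDiagram (nonZeroDivisors (𝓞 F))).obj s).left from (𝓜.total ◁ τ).left)).baseChange
                    ((𝓜.localise w).genericIso'.inv.left ≫ pullback.fst (𝓜.localise w).total.hom
                      (Literature.NumberTheory.EllipticCurves.specGenericPoint (HeightOneSpectrum.valuationSubringAtPrime F w) F))).baseChange t).hat.X.left ⟶
                  (D₁.baseChange t).hat.X.left),
              (((φ.baseChange (show (𝓜.localise w).total.left ⟶ (𝓜.total ⊗ (baseDiagram (nonZeroDivisors (𝓞 F))).obj s).left from (𝓜.total ◁ τ).left)).baseChange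
                    ((𝓜.localise w).genericIso'.inv.left ≫ pullback.fst (𝓜.localise w).total.hom
                      (Literature.NumberTheory.EllipticCurves.specGenericPoint (HeightOneSpectrum.valuationSubringAtPrime F w) F))).baseChange t).IsBaseChangeVia
                  (φ₁.baseChange t) (𝟙 T') G ∧
              (((D.baseChange (show (𝓜.localise w).total.left ⟶ (𝓜.total ⊗ (baseDiagram (nonZeroDivisors (𝓞 F))).obj s).left from (𝓜.total ◁ τ).left)).baseChange
                    ((𝓜.localise w).genericIso'.inv.left ≫ pullback.fst (𝓜.localise w).total.hom
                      (Literature.NumberTheory.EllipticCurves.specGenericPoint (HeightOneSpectrum.valuationSubringAtPrime F w) F))).baseChange t).hat.IsBaseChangeVia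
                  (D₁.baseChange t).hat (𝟙 T') Ĝ ∧
              (∃ (wG : (((𝒜.baseChange (show (𝓜.localise w).total.left ⟶ (𝓜.total ⊗ (baseDiagram (nonZeroDivisors (𝓞 F))).obj s).left from (𝓜.total ◁ τ).left)).baseChange
                        ((𝓜.localise w).genericIso'.inv.left ≫ pullback.fst (𝓜.localise w).total.hom
                          (Literature.NumberTheory.EllipticCurves.specGenericPoint (HeightOneSpectrum.valuationSubringAtPrime F w) F))).baseChange t).X.hom ≫ 𝟙 T' =
                      G ≫ (A₁.baseChange t).X.hom)
                  (wĜ : (((D.baseChange (show (𝓜.localise w).total.left ⟶ (𝓜.total ⊗ (baseDiagram (nonZeroDivisors (𝓞 F))).obj s).left from (𝓜.total ◁ τ).left)).baseChange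
                        ((𝓜.localise w).genericIso'.inv.left ≫ pullback.fst (𝓜.localise w).total.hom
                          (Literature.NumberTheory.EllipticCurves.specGenericPoint (HeightOneSpectrum.valuationSubringAtPrime F w) F))).baseChange t).hat.X.hom ≫ 𝟙 T' =
                      Ĝ ≫ (D₁.baseChange t).hat.X.hom),
                Nonempty ((Scheme.Modules.pullback
                  (pullback.map
                    (((𝒜.baseChange (show (𝓜.localise w).total.left ⟶ (𝓜.total ⊗ (baseDiagram (nonZeroDivisors (𝓞 F))).obj s).left from (𝓜.total ◁ τ).left)).baseChange
                        ((𝓜.localise w).genericIso'.inv.left ≫ pullback.fst (𝓜.localise w).total.hom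
                          (Literature.NumberTheory.EllipticCurves.specGenericPoint (HeightOneSpectrum.valuationSubringAtPrime F w) F))).baseChange t).X.hom
                    (((D.baseChange (show (𝓜.localise w).total.left ⟶ (𝓜.total ⊗ (baseDiagram (nonZeroDivisors (𝓞 F))).obj s).left from (𝓜.total ◁ τ).left)).baseChange
                        ((𝓜.localise w).genericIso'.inv.left ≫ pullback.fst (𝓜.localise w).total.hom
                          (Literature.NumberTheory.EllipticCurves.specGenericPoint (HeightOneSpectrum.valuationSubringAtPrime F w) F))).baseChange t).hat.X.hom
                    (A₁.baseChange t).X.hom (D₁.baseChange t).hat.X.hom G Ĝ (𝟙 T') wG wĜ)).obj (D₁.baseChange t).P ≅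
                  (((D.baseChange (show (𝓜.localise w).total.left ⟶ (𝓜.total ⊗ (baseDiagram (nonZeroDivisors (𝓞 F))).obj s).left from (𝓜.total ◁ τ).left)).baseChange
                        ((𝓜.localise w).genericIso'.inv.left ≫ pullback.fst (𝓜.localise w).total.hom
                          (Literature.NumberTheory.EllipticCurves.specGenericPoint (HeightOneSpectrum.valuationSubringAtPrime F w) F))).baseChange t).P)) ∧
              (((pol.baseChange (show (𝓜.localise w).total.left ⟶ (𝓜.total ⊗ (baseDiagram (nonZeroDivisors (𝓞 F))).obj s).left from (𝓜.total ◁ τ).left)).baseChange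
                    ((𝓜.localise w).genericIso'.inv.left ≫ pullback.fst (𝓜.localise w).total.hom
                      (Literature.NumberTheory.EllipticCurves.specGenericPoint (HeightOneSpectrum.valuationSubringAtPrime F w) F))).baseChange t).lam.left ≫ Ĝ =
                G ≫ (pol₁.baseChange t).lam.left ∧
              ∀ a : O, (AbelianSchemeOver.baseChangeHom
                    (((ρ.baseChange (show (𝓜.localise w).total.left ⟶ (𝓜.total ⊗ (baseDiagram (nonZeroDivisors (𝓞 F))).obj s).left from (𝓜.total ◁ τ).left)).baseChange
                      ((𝓜.localise w).genericIso'.inv.left ≫ pullback.fst (𝓜.localise w).total.hom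
                        (Literature.NumberTheory.EllipticCurves.specGenericPoint (HeightOneSpectrum.valuationSubringAtPrime F w) F))).i a) t).left ≫ G =
                  G ≫ (AbelianSchemeOver.baseChangeHom (ρ₁.i a) t).left := by
  classical
  haveI := 𝓜.isLocallyNoetherian_tensorObj_specOver_left
  haveI := 𝓜.isReduced_tensorObj_specOver_left
  obtain ⟨s, 𝒜, ρ, D, pol, φ, hg', -, ⟨-, hros, ν, hν, hνeq⟩, S₀, hS₀, hread⟩ :=
    𝓜.exists_stage_pelTuple_rows_cofinite_of_stageDuals bs A₁ ρ₁ D₁ pol₁ φ₁ hg (𝓜.stageDuals_of_letter_genericIso hD A₁ D₁ pol₁) r hros₁ d ν₁ hν₁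
  have hdF : ((d : ℕ) : 𝓞 F) ≠ 0 := Nat.cast_ne_zero.mpr hd
  refine ⟨s, 𝒜, ρ, D, pol, φ, S₀ ∪ {w | ((d : ℕ) : 𝓞 F) ∈ w.asIdeal}, hS₀.union (finite_setOf_natCast_mem_asIdeal hdF), fun w hw => ?_⟩
  obtain ⟨τ, hτ⟩ := hread w (fun h => hw (Or.inl h))
  have hdw : ((d : ℕ) : 𝓞 F) ∉ w.asIdeal := fun h => hw (Or.inr h)
  haveI := 𝓜.isLocallyNoetherian_localise_total_left w
  -- the tower morphism `κ_w : Spec F → Spec 𝒪_{F,(w)}` over `Spec 𝓞 F`, and `genIncl = genericIso⁻¹ ≫ (𝓜.total ◁ κ_w)`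
  let κ : specOver (𝓞 F) F ⟶ specOver (𝓞 F) (HeightOneSpectrum.valuationSubringAtPrime F w) :=
    Over.homMk (Spec.map (CommRingCat.ofHom (algebraMap (HeightOneSpectrum.valuationSubringAtPrime F w) F))) (by
      change Spec.map _ ≫ Spec.map _ = Spec.map _
      rw [← Spec.map_comp, ← CommRingCat.ofHom_comp, ← IsScalarTower.algebraMap_eq])
  have hgen : (𝓜.localise w).genericIso'.inv.left ≫ pullback.fst (𝓜.localise w).total.hom
      (Literature.NumberTheory.EllipticCurves.specGenericPoint (HeightOneSpectrum.valuationSubringAtPrime F w) F) =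
      𝓜.genericIso.inv.left ≫ (𝓜.total ◁ κ).left :=
    genericIso'_inv_left_comp_fst 𝓜 w κ rfl
  refine ⟨τ, hg'.baseChange _, AbelianSchemeOver.isCommMonObj_of_isLocallyNoetherian_base _,
    RingAction.rosati_row_baseChange _ ρ D pol.lam r hros, fun p hp hpw => ?_, fun {T'} t => ?_⟩
  · exact exists_monHom_comp_eq_mulN_baseChange _ pol.lam (fun d' => p.Coprime d')
      ⟨d, ν, hν, coprime_of_natCast_mem_of_natCast_not_mem w.asIdeal hp hpw hdw, hνeq⟩
  · rw [hgen]
    exact hτ κ t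

end Head

/-! ### §4 The same over the Galois thickening of a smooth projective curve, for a polarisation of type `δ` -/

section ThickeningInstances

variable {F : Type} [Field F] {Fi : Type} [Field Fi] [Algebra F Fi] (X₀ : SchemeOver F) [SmoothOfRelativeDimension 1 X₀.hom]

/-- `R_{Fᵢ} X₀ = X₀ ⊗_F Fᵢ → Spec Fᵢ` is smooth when `X₀ → Spec F` is (base change of a smooth morphism). [cite: EGAIV4, 17.3.3 (iii)] -/
theorem smooth_baseChange_obj_hom : Smooth ((baseChange F Fi).obj X₀).hom := by
  haveI : Smooth X₀.hom := SmoothOfRelativeDimension.smooth (n := 1) (f := X₀.hom)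
  change Smooth (pullback.snd X₀.hom (Spec.map (CommRingCat.ofHom (algebraMap F Fi))))
  infer_instance

/-- The total space of `R_{Fᵢ} X₀` is reduced (smooth over the field `Fᵢ`, ★ `isReduced_of_smooth`: the local rings are regular, hence domains). [folklore] [cite: EGAIV4, 17.3.3 (iii)] -/
theorem isReduced_thickening_left : IsReduced ((thickening F Fi).obj X₀).left := by
  haveI := smooth_baseChange_obj_hom (Fi := Fi) X₀
  exact Literature.AlgebraicGeometry.Resolution.isReduced_of_smooth ((baseChange F Fi).obj X₀).hom

/-- The total space of `R_{Fᵢ} X₀` is locally Noetherian (locally of finite type over the field `Fᵢ`). [cite: GortzWedhorn2020, §(10.13) (pp. 261–262)] -/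
theorem isLocallyNoetherian_thickening_left : IsLocallyNoetherian ((thickening F Fi).obj X₀).left := by
  haveI := smooth_baseChange_obj_hom (Fi := Fi) X₀
  exact LocallyOfFiniteType.isLocallyNoetherian ((baseChange F Fi).obj X₀).hom

end ThickeningInstances

section Thickening

variable {F : Type} [Field F] [NumberField F] {Fi : Type} [Field Fi] [NumberField Fi] [Algebra F Fi]
  (X₀ : SchemeOver F) [SmoothOfRelativeDimension 1 X₀.hom]
  (𝓜 : IntegralModel (𝓞 F) F ((thickening F Fi).obj X₀))
  [QuasiCompact 𝓜.total.hom] [QuasiSeparated 𝓜.total.hom] [LocallyOfFinitePresentation 𝓜.total.hom] [IsSeparated 𝓜.total.hom] [Flat 𝓜.total.hom]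

/-- **THE SPREAD PEL TUPLE AT THE LOCALISATION, COFINITELY IN `w`, FROM THE DUALS LETTER — over the Galois thickening `R_{Fᵢ} X₀` of a smooth projective
curve and for a polarisation of TYPE `δ`** (the E-witness currency of the closer leaf: `A₁ := E.P.A` over `(S.M Kc) ⊗_F Fᵢ`, `E.P.hasType`, `E.rosati`):
§3 with its instances discharged (★ `isProper_thickening`, `isReduced_thickening_left`, `isLocallyNoetherian_thickening_left`) and the E-side quasi-inverse
`λ₁ ≫ ν₁ = [∏ δᵢ]` supplied by ★ `Polarization.exists_monHom_quasiInverse_of_hasType_of_charZero` (characteristic `0`, `∏ δᵢ ≠ 0`).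
[cite: EGAIV3, Thm. 8.8.2, (8.8.2.5) and Thm. 8.10.5] [cite: MumfordAV1970, §7 Thm. 4 (p. 72); §13 (pp. 123–125)]
[cite: MumfordFogartyKirwan1994, Ch. 7 §2 Definition 7.2 (p. 129); App. 7A (pp. 234–235)] [cite: RapoportSmithlingZhang2020Diagonal, §4.1 Thm. 4.1 (p. 17)]
[cite: Kottwitz1992, §5 (pp. 389–391)] [cite: SerreTate1968, §1] -/
theorem exists_stage_pelTuple_localised_rows_of_letter_thickening (hX₀ : IsProjectiveOver X₀)
    (hD : ∀ (R : Type) [CommRing R] [IsNoetherianRing R] (A : AbelianSchemeOver (Spec (.of R)))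
      (_hA : IsProjective A.X.hom) (L : A.left.Modules) (hL : HasRank L 1),
      CechPic.pullback A.unitSection (detClass (HasRank.isFiniteLocallyFree' hL)) = 1 →
      (∀ ⦃Ω : Type⦄ [Field Ω] [IsAlgClosed Ω] (s : Spec (.of Ω) ⟶ Spec (.of R)),
        ∃ Θ : CartierDivisor (A.fibre s).toAbelianVariety.X.left, Θ.IsAmple ∧
          CechPic.pullback (X := (A.fibre s).toAbelianVariety.X.left) (pullback.fst A.X.hom s)
            (detClass (HasRank.isFiniteLocallyFree' hL)) = Θ.cechClass) →
      ∀ (n : ℕ), IsUnit ((n : ℕ) : R) →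
        (∀ (T : Over (Spec (.of R))) (u : T ⟶ A.X), A.MemKOfL L u → u ^ n = 1) →
        Nonempty A.DualPair)
    {O : Type*} [CommRing O] {m : ℕ} (bs : Module.Basis (Fin m) ℤ O) {g N : ℕ} [NeZero N] {δ : Fin g → ℕ}
    (A₁ : AbelianSchemeOver ((thickening F Fi).obj X₀).left) (ρ₁ : RingAction O A₁) (D₁ : A₁.DualPair) (pol₁ : A₁.Polarization D₁)
    (hT : pol₁.HasType δ) (φ₁ : A₁.LevelStructure g N) (hg : A₁.IsOfRelDim g)
    (r : O → O → Prop)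
    (hros₁ : ∀ b b' : O, r b b' → haveI := ρ₁.isMonHom b; ρ₁.i b' ≫ pol₁.lam = pol₁.lam ≫ DualPair.dualIsogenyOver (ρ₁.i b) D₁ D₁) :
    ∃ (s : Idx (nonZeroDivisors (𝓞 F))) (𝒜 : AbelianSchemeOver (𝓜.total ⊗ (baseDiagram (nonZeroDivisors (𝓞 F))).obj s).left)
      (ρ : RingAction O 𝒜) (D : 𝒜.DualPair) (pol : 𝒜.Polarization D) (φ : 𝒜.LevelStructure g N),
      ∃ S : Set (HeightOneSpectrum (𝓞 F)), S.Finite ∧ ∀ w : HeightOneSpectrum (𝓞 F), w ∉ S →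
        ∃ τ : specOver (𝓞 F) (HeightOneSpectrum.valuationSubringAtPrime F w) ⟶ (baseDiagram (nonZeroDivisors (𝓞 F))).obj s,
          (𝒜.baseChange (show (𝓜.localise w).total.left ⟶ (𝓜.total ⊗ (baseDiagram (nonZeroDivisors (𝓞 F))).obj s).left from (𝓜.total ◁ τ).left)).IsOfRelDim g ∧
          IsCommMonObj (𝒜.baseChange (show (𝓜.localise w).total.left ⟶ (𝓜.total ⊗ (baseDiagram (nonZeroDivisors (𝓞 F))).obj s).left from (𝓜.total ◁ τ).left)).X ∧
          (∀ b b' : O, r b b' →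
            haveI := (ρ.baseChange (show (𝓜.localise w).total.left ⟶ (𝓜.total ⊗ (baseDiagram (nonZeroDivisors (𝓞 F))).obj s).left from (𝓜.total ◁ τ).left)).isMonHom b
            (ρ.baseChange (show (𝓜.localise w).total.left ⟶ (𝓜.total ⊗ (baseDiagram (nonZeroDivisors (𝓞 F))).obj s).left from (𝓜.total ◁ τ).left)).i b' ≫
                (pol.baseChange (show (𝓜.localise w).total.left ⟶ (𝓜.total ⊗ (baseDiagram (nonZeroDivisors (𝓞 F))).obj s).left from (𝓜.total ◁ τ).left)).lam =
              (pol.baseChange (show (𝓜.localise w).total.left ⟶ (𝓜.total ⊗ (baseDiagram (nonZeroDivisors (𝓞 F))).obj s).left from (𝓜.total ◁ τ).left)).lam ≫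
                DualPair.dualIsogenyOver
                  ((ρ.baseChange (show (𝓜.localise w).total.left ⟶ (𝓜.total ⊗ (baseDiagram (nonZeroDivisors (𝓞 F))).obj s).left from (𝓜.total ◁ τ).left)).i b)
                  (D.baseChange (show (𝓜.localise w).total.left ⟶ (𝓜.total ⊗ (baseDiagram (nonZeroDivisors (𝓞 F))).obj s).left from (𝓜.total ◁ τ).left))
                  (D.baseChange (show (𝓜.localise w).total.left ⟶ (𝓜.total ⊗ (baseDiagram (nonZeroDivisors (𝓞 F))).obj s).left from (𝓜.total ◁ τ).left))) ∧
          (∀ p : ℕ, p.Prime → (p : 𝓞 F) ∈ w.asIdeal →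
            ∃ (d' : ℕ) (ν : (D.baseChange (show (𝓜.localise w).total.left ⟶ (𝓜.total ⊗ (baseDiagram (nonZeroDivisors (𝓞 F))).obj s).left from (𝓜.total ◁ τ).left)).hat.X ⟶
                (𝒜.baseChange (show (𝓜.localise w).total.left ⟶ (𝓜.total ⊗ (baseDiagram (nonZeroDivisors (𝓞 F))).obj s).left from (𝓜.total ◁ τ).left)).X),
              IsMonHom ν ∧ p.Coprime d' ∧
                (pol.baseChange (show (𝓜.localise w).total.left ⟶ (𝓜.total ⊗ (baseDiagram (nonZeroDivisors (𝓞 F))).obj s).left from (𝓜.total ◁ τ).left)).lam ≫ ν =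
                  (𝒜.baseChange (show (𝓜.localise w).total.left ⟶ (𝓜.total ⊗ (baseDiagram (nonZeroDivisors (𝓞 F))).obj s).left from (𝓜.total ◁ τ).left)).mulN d') ∧
          ∀ {T' : Scheme.{0}} (t : T' ⟶ ((thickening F Fi).obj X₀).left),
            ∃ (G : (((𝒜.baseChange (show (𝓜.localise w).total.left ⟶ (𝓜.total ⊗ (baseDiagram (nonZeroDivisors (𝓞 F))).obj s).left from (𝓜.total ◁ τ).left)).baseChange
                    ((𝓜.localise w).genericIso'.inv.left ≫ pullback.fst (𝓜.localise w).total.hom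
                      (Literature.NumberTheory.EllipticCurves.specGenericPoint (HeightOneSpectrum.valuationSubringAtPrime F w) F))).baseChange t).X.left ⟶
                  (A₁.baseChange t).X.left)
              (Ĝ : (((D.baseChange (show (𝓜.localise w).total.left ⟶ (𝓜.total ⊗ (baseDiagram (nonZeroDivisors (𝓞 F))).obj s).left from (𝓜.total ◁ τ).left)).baseChange
                    ((𝓜.localise w).genericIso'.inv.left ≫ pullback.fst (𝓜.localise w).total.hom
                      (Literature.NumberTheory.EllipticCurves.specGenericPoint (HeightOneSpectrum.valuationSubringAtPrime F w) F))).baseChange t).hat.X.left ⟶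
                  (D₁.baseChange t).hat.X.left),
              (((φ.baseChange (show (𝓜.localise w).total.left ⟶ (𝓜.total ⊗ (baseDiagram (nonZeroDivisors (𝓞 F))).obj s).left from (𝓜.total ◁ τ).left)).baseChange
                    ((𝓜.localise w).genericIso'.inv.left ≫ pullback.fst (𝓜.localise w).total.hom
                      (Literature.NumberTheory.EllipticCurves.specGenericPoint (HeightOneSpectrum.valuationSubringAtPrime F w) F))).baseChange t).IsBaseChangeVia
                  (φ₁.baseChange t) (𝟙 T') G ∧
              (((D.baseChange (show (𝓜.localise w).total.left ⟶ (𝓜.total ⊗ (baseDiagram (nonZeroDivisors (𝓞 F))).obj s).left from (𝓜.total ◁ τ).left)).baseChange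
                    ((𝓜.localise w).genericIso'.inv.left ≫ pullback.fst (𝓜.localise w).total.hom
                      (Literature.NumberTheory.EllipticCurves.specGenericPoint (HeightOneSpectrum.valuationSubringAtPrime F w) F))).baseChange t).hat.IsBaseChangeVia
                  (D₁.baseChange t).hat (𝟙 T') Ĝ ∧
              (∃ (wG : (((𝒜.baseChange (show (𝓜.localise w).total.left ⟶ (𝓜.total ⊗ (baseDiagram (nonZeroDivisors (𝓞 F))).obj s).left from (𝓜.total ◁ τ).left)).baseChange
                        ((𝓜.localise w).genericIso'.inv.left ≫ pullback.fst (𝓜.localise w).total.hom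
                          (Literature.NumberTheory.EllipticCurves.specGenericPoint (HeightOneSpectrum.valuationSubringAtPrime F w) F))).baseChange t).X.hom ≫ 𝟙 T' =
                      G ≫ (A₁.baseChange t).X.hom)
                  (wĜ : (((D.baseChange (show (𝓜.localise w).total.left ⟶ (𝓜.total ⊗ (baseDiagram (nonZeroDivisors (𝓞 F))).obj s).left from (𝓜.total ◁ τ).left)).baseChange
                        ((𝓜.localise w).genericIso'.inv.left ≫ pullback.fst (𝓜.localise w).total.hom
                          (Literature.NumberTheory.EllipticCurves.specGenericPoint (HeightOneSpectrum.valuationSubringAtPrime F w) F))).baseChange t).hat.X.hom ≫ 𝟙 T' =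
                      Ĝ ≫ (D₁.baseChange t).hat.X.hom),
                Nonempty ((Scheme.Modules.pullback
                  (pullback.map
                    (((𝒜.baseChange (show (𝓜.localise w).total.left ⟶ (𝓜.total ⊗ (baseDiagram (nonZeroDivisors (𝓞 F))).obj s).left from (𝓜.total ◁ τ).left)).baseChange
                        ((𝓜.localise w).genericIso'.inv.left ≫ pullback.fst (𝓜.localise w).total.hom
                          (Literature.NumberTheory.EllipticCurves.specGenericPoint (HeightOneSpectrum.valuationSubringAtPrime F w) F))).baseChange t).X.hom
                    (((D.baseChange (show (𝓜.localise w).total.left ⟶ (𝓜.total ⊗ (baseDiagram (nonZeroDivisors (𝓞 F))).obj s).left from (𝓜.total ◁ τ).left)).baseChange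
                        ((𝓜.localise w).genericIso'.inv.left ≫ pullback.fst (𝓜.localise w).total.hom
                          (Literature.NumberTheory.EllipticCurves.specGenericPoint (HeightOneSpectrum.valuationSubringAtPrime F w) F))).baseChange t).hat.X.hom
                    (A₁.baseChange t).X.hom (D₁.baseChange t).hat.X.hom G Ĝ (𝟙 T') wG wĜ)).obj (D₁.baseChange t).P ≅
                  (((D.baseChange (show (𝓜.localise w).total.left ⟶ (𝓜.total ⊗ (baseDiagram (nonZeroDivisors (𝓞 F))).obj s).left from (𝓜.total ◁ τ).left)).baseChange
                        ((𝓜.localise w).genericIso'.inv.left ≫ pullback.fst (𝓜.localise w).total.hom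
                          (Literature.NumberTheory.EllipticCurves.specGenericPoint (HeightOneSpectrum.valuationSubringAtPrime F w) F))).baseChange t).P)) ∧
              (((pol.baseChange (show (𝓜.localise w).total.left ⟶ (𝓜.total ⊗ (baseDiagram (nonZeroDivisors (𝓞 F))).obj s).left from (𝓜.total ◁ τ).left)).baseChange
                    ((𝓜.localise w).genericIso'.inv.left ≫ pullback.fst (𝓜.localise w).total.hom
                      (Literature.NumberTheory.EllipticCurves.specGenericPoint (HeightOneSpectrum.valuationSubringAtPrime F w) F))).baseChange t).lam.left ≫ Ĝ =
                G ≫ (pol₁.baseChange t).lam.left ∧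
              ∀ a : O, (AbelianSchemeOver.baseChangeHom
                    (((ρ.baseChange (show (𝓜.localise w).total.left ⟶ (𝓜.total ⊗ (baseDiagram (nonZeroDivisors (𝓞 F))).obj s).left from (𝓜.total ◁ τ).left)).baseChange
                      ((𝓜.localise w).genericIso'.inv.left ≫ pullback.fst (𝓜.localise w).total.hom
                        (Literature.NumberTheory.EllipticCurves.specGenericPoint (HeightOneSpectrum.valuationSubringAtPrime F w) F))).i a) t).left ≫ G =
                  G ≫ (AbelianSchemeOver.baseChangeHom (ρ₁.i a) t).left := by
  haveI : IsProper ((thickening F Fi).obj X₀).hom := isProper_thickening (Fi := Fi) X₀ hX₀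
  haveI := isReduced_thickening_left (Fi := Fi) X₀
  haveI := isLocallyNoetherian_thickening_left (Fi := Fi) X₀
  obtain ⟨ν₁, hν₁, hlam, -, -, -⟩ :=
    Polarization.exists_monHom_quasiInverse_of_hasType_of_charZero pol₁ ((thickening F Fi).obj X₀).hom hT
  haveI := hν₁
  have hδ : (∏ i, δ i) ≠ 0 := Finset.prod_ne_zero_iff.mpr fun i _ => (hT.isPolarizationType.1 i).ne'
  exact 𝓜.exists_stage_pelTuple_localised_rows_of_letter hD bs A₁ ρ₁ D₁ pol₁ φ₁ hg r hros₁ hδ ν₁ hlam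

end Thickening

end IntegralModel

end Literature.AlgebraicGeometry.Motives

end
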